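import Summits.Ventures.PercRepro.RankLevelSetUpFiveValid
import Summits.Ventures.PercRepro.RankLevelSetUpFiveDegree

/-! # RankLevelSetUpFiveUseful — EVERY BAD MEMBER OFF ITS LINE HAS A USEFUL COLOOP (night-1 g41; dossier
§53.5 (a), Cases I and II; on `RankLevelSetUpFiveValid` and `RankLevelSetUpFiveDegree`)

For a bad member `W ∋ b` with coloops `C = {c₁, c₂, c₃}` and line points `L'` (`b ∉ cl L'`), a type-B target needs
a coloop `c` that is VALID (`b ∉ cl (L' ∪ (C ∖ c))`) together with a line point `ℓ ∈ L'` with `{ℓ, c} ⊄ H`,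
`H := cl (W ∖ b)`. **`exists_useful_coloop`**: such a pair always exists. CASE I (`L' ⊄ H`): a valid coloop exists
by the triangle lemma and `L' ∖ H` has `≥ 2` points. CASE II (`L' ⊆ H`): a valid coloop OFF `H` exists — if two
coloops lie in `H` then `H = cl (L' ∪ {c_i, c_j}) ∌ b` and the third is valid and off `H`; if exactly one lies in
`H` the other two cannot both be invalid (the two sides through the vertex in `H` meet in its plane, inside `H`, which
misses `b`); if none lies in `H` the triangle lemma decides — and then every `ℓ ∈ L'` works. Every declaration has
a docstring; imports: the cell's own modules and Mathlib only. Axioms: standard. -/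

namespace PercRepro

open Set Matroid

variable {α : Type}

/-- **Two sides through a vertex inside `H` meet inside `H`**: if `c₁ ∈ H := cl R` with `L' ⊆ H`, and `b` lies on
both `cl (L' ∪ {c₁, c₂})` and `cl (L' ∪ {c₁, c₃})`, then `b ∈ H` — for `rk L' = 2`, `rk (L' ∪ {c₁,c₂,c₃}) = 5`. -/
lemma mem_closure_of_two_sides {N : Matroid α} [N.Finite] {L' R : Set α} (hLE : L' ⊆ N.E) (hL : N.eRk L' = 2)
    {c₁ c₂ c₃ : α} (hc₁ : c₁ ∈ N.E) (hc₂ : c₂ ∈ N.E) (hc₃ : c₃ ∈ N.E)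
    (hC : N.eRk (insert c₁ (insert c₂ (insert c₃ L'))) = 5) {b : α} (hb : b ∈ N.E)
    (hLH : L' ⊆ N.closure R) (hc₁H : c₁ ∈ N.closure R)
    (h₂ : b ∈ N.closure (insert c₁ (insert c₂ L'))) (h₃ : b ∈ N.closure (insert c₁ (insert c₃ L'))) :
    b ∈ N.closure R := by
  -- `b ∈ cl (L' ∪ {c₁})`
  have hC₁ : N.eRk (insert c₂ (insert c₃ (insert c₁ L'))) = 5 := by
    rw [show insert c₂ (insert c₃ (insert c₁ L')) = insert c₁ (insert c₂ (insert c₃ L')) from by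
      ext x; simp only [Set.mem_insert_iff]; tauto]
    exact hC
  have hC₂ : N.eRk (insert c₃ (insert c₁ (insert c₂ L'))) = 5 := by
    rw [show insert c₃ (insert c₁ (insert c₂ L')) = insert c₁ (insert c₂ (insert c₃ L')) from by
      ext x; simp only [Set.mem_insert_iff]; tauto]
    exact hC
  have hC₃ : N.eRk (insert c₂ (insert c₁ (insert c₃ L'))) = 5 := by
    rw [show insert c₂ (insert c₁ (insert c₃ L')) = insert c₁ (insert c₂ (insert c₃ L')) from by
      ext x; simp only [Set.mem_insert_iff]; tauto]
    exact hC
  obtain ⟨hr1, -⟩ := eRk_insert_of_triangle hL hC₁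
  obtain ⟨-, hr12⟩ := eRk_insert_of_triangle hL hC₂
  obtain ⟨-, hr13⟩ := eRk_insert_of_triangle hL hC₃
  have hb1 : b ∈ N.closure (insert c₁ L') := by
    refine mem_closure_of_mem_inter_closure hb h₂ h₃ ?_ (r := 4) (u := 5) hr12.le hr13.le ?_ (by norm_num) ?_
    · intro x hx
      exact ⟨N.subset_closure _ (Set.insert_subset hc₁ (Set.insert_subset hc₂ hLE))
          (by rcases hx with rfl | hx
              · exact Set.mem_insert _ _
              · exact Set.mem_insert_of_mem _ (Set.mem_insert_of_mem _ hx)),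
        N.subset_closure _ (Set.insert_subset hc₁ (Set.insert_subset hc₃ hLE))
          (by rcases hx with rfl | hx
              · exact Set.mem_insert _ _
              · exact Set.mem_insert_of_mem _ (Set.mem_insert_of_mem _ hx))⟩
    · have e : insert c₁ (insert c₂ L') ∪ insert c₁ (insert c₃ L') = insert c₁ (insert c₂ (insert c₃ L')) := by
        ext x; simp only [Set.mem_union, Set.mem_insert_iff]; tauto
      rw [e, hC]; norm_num
    · rw [hr1]; norm_num
  -- and `cl (L' ∪ {c₁}) ⊆ H`
  have hsub : insert c₁ L' ⊆ N.closure R := Set.insert_subset hc₁H hLH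
  exact N.closure_subset_closure_of_subset_closure hsub hb1

/-- **EVERY BAD MEMBER OFF ITS LINE HAS A USEFUL COLOOP** (night-1 g41, §53.5 (a)): `N` of rank `5`, loopless,
without a parallel triple; `W` a base through `b`, `L'` of rank `2` with `≥ 4` elements and `b ∉ cl L'`, the three
coloops `c₁, c₂, c₃` (distinct, off `W`, with `rk (L' ∪ {c₁,c₂,c₃}) = 5`). Then some `c ∈ {c₁, c₂, c₃}` is valid —
`b ∉ cl (L' ∪ ({c₁,c₂,c₃} ∖ c))` — and admits a line point `ℓ ∈ L'` with `{ℓ, c} ⊄ cl (W ∖ b)`. -/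
theorem exists_useful_coloop {N : Matroid α} [N.Finite] (h5 : N.eRank = 5)
    (hnl : ∀ e ∈ N.E, N.IsNonloop e)
    (hnt : ∀ p ∈ N.E, ∀ q ∈ N.E, ∀ r ∈ N.E, p ≠ q → p ≠ r → q ≠ r → q ∈ N.closure {p} → r ∉ N.closure {p})
    {W : Set α} (hW : N.IsBase W) {b : α} (hb : b ∈ W) {L' : Set α} (hLE : L' ⊆ N.E) (hL : N.eRk L' = 2)
    (hL4 : 4 ≤ L'.ncard) (hbL : b ∉ N.closure L') {c₁ c₂ c₃ : α} (hc₁ : c₁ ∈ N.E) (hc₂ : c₂ ∈ N.E)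
    (hc₃ : c₃ ∈ N.E) (hC : N.eRk (insert c₁ (insert c₂ (insert c₃ L'))) = 5) :
    ∃ c ∈ ({c₁, c₂, c₃} : Set α), b ∉ N.closure (L' ∪ ({c₁, c₂, c₃} \ {c})) ∧
      ∃ ℓ ∈ L', ¬ ({ℓ, c} ⊆ N.closure (W \ {b})) := by
  classical
  have hbE : b ∈ N.E := hW.subset_ground hb
  have hbH : b ∉ N.closure (W \ {b}) := by
    intro h
    have hI : N.Indep W := hW.indep
    have hbR : b ∉ W \ {b} := fun h => h.2 rfl
    have : N.Indep (insert b (W \ {b})) := by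
      rw [Set.insert_sdiff_singleton, Set.insert_eq_of_mem hb]; exact hI
    exact ((hI.subset Set.sdiff_subset).insert_indep_iff_of_notMem hbR).mp this |>.2 h
  -- the rank of `W ∖ b` is `4`
  have hR4 : N.eRk (W \ {b}) = 4 := by
    have hRi : N.Indep (W \ {b}) := hW.indep.subset Set.sdiff_subset
    rw [hRi.eRk_eq_encard, Set.encard_sdiff_singleton_of_mem hb, hW.encard_eq_eRank, h5]; rfl
  -- the three sides, written with `L' ∪ (C ∖ c)`
  have e₁ : L' ∪ ({c₁, c₂, c₃} \ {c₁}) ⊆ insert c₂ (insert c₃ L') := by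
    intro x hx
    simp only [Set.mem_union, Set.mem_sdiff, Set.mem_insert_iff, Set.mem_singleton_iff] at hx ⊢
    tauto
  have e₂ : L' ∪ ({c₁, c₂, c₃} \ {c₂}) ⊆ insert c₁ (insert c₃ L') := by
    intro x hx
    simp only [Set.mem_union, Set.mem_sdiff, Set.mem_insert_iff, Set.mem_singleton_iff] at hx ⊢
    tauto
  have e₃ : L' ∪ ({c₁, c₂, c₃} \ {c₃}) ⊆ insert c₁ (insert c₂ L') := by
    intro x hx
    simp only [Set.mem_union, Set.mem_sdiff, Set.mem_insert_iff, Set.mem_singleton_iff] at hx ⊢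
    tauto
  have v₁ : b ∉ N.closure (insert c₂ (insert c₃ L')) → b ∉ N.closure (L' ∪ ({c₁, c₂, c₃} \ {c₁})) :=
    fun h h' => h (N.closure_subset_closure e₁ h')
  have v₂ : b ∉ N.closure (insert c₁ (insert c₃ L')) → b ∉ N.closure (L' ∪ ({c₁, c₂, c₃} \ {c₂})) :=
    fun h h' => h (N.closure_subset_closure e₂ h')
  have v₃ : b ∉ N.closure (insert c₁ (insert c₂ L')) → b ∉ N.closure (L' ∪ ({c₁, c₂, c₃} \ {c₃})) :=
    fun h h' => h (N.closure_subset_closure e₃ h')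
  have hm₁ : c₁ ∈ ({c₁, c₂, c₃} : Set α) := Set.mem_insert _ _
  have hm₂ : c₂ ∈ ({c₁, c₂, c₃} : Set α) := Set.mem_insert_of_mem _ (Set.mem_insert _ _)
  have hm₃ : c₃ ∈ ({c₁, c₂, c₃} : Set α) := Set.mem_insert_of_mem _ (Set.mem_insert_of_mem _ rfl)
  have hfin : L'.Finite := N.ground_finite.subset hLE
  -- the permuted rank hypotheses for the two-sides lemma
  have hC₂ : N.eRk (insert c₂ (insert c₁ (insert c₃ L'))) = 5 := by
    rw [Set.insert_comm c₂ c₁]; exact hC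
  have hC₃ : N.eRk (insert c₃ (insert c₁ (insert c₂ L'))) = 5 := by
    rw [Set.insert_comm c₃ c₁, Set.insert_comm c₃ c₂]; exact hC
  -- the two-sides lemma, specialised to the three vertices
  have two₁ : L' ⊆ N.closure (W \ {b}) → c₁ ∈ N.closure (W \ {b}) → b ∈ N.closure (insert c₁ (insert c₂ L')) →
      b ∈ N.closure (insert c₁ (insert c₃ L')) → False :=
    fun hLH h1 hv hv' => hbH (mem_closure_of_two_sides hLE hL hc₁ hc₂ hc₃ hC hbE hLH h1 hv hv')
  have two₂ : L' ⊆ N.closure (W \ {b}) → c₂ ∈ N.closure (W \ {b}) → b ∈ N.closure (insert c₁ (insert c₂ L')) →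
      b ∈ N.closure (insert c₂ (insert c₃ L')) → False := by
    intro hLH h2 hv hv'
    have hv₀ : b ∈ N.closure (insert c₂ (insert c₁ L')) := by rw [Set.insert_comm]; exact hv
    exact hbH (mem_closure_of_two_sides hLE hL hc₂ hc₁ hc₃ hC₂ hbE hLH h2 hv₀ hv')
  have two₃ : L' ⊆ N.closure (W \ {b}) → c₃ ∈ N.closure (W \ {b}) → b ∈ N.closure (insert c₁ (insert c₃ L')) →
      b ∈ N.closure (insert c₂ (insert c₃ L')) → False := by
    intro hLH h3 hv hv'
    have hv₀ : b ∈ N.closure (insert c₃ (insert c₁ L')) := by rw [Set.insert_comm]; exact hv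
    have hv₁ : b ∈ N.closure (insert c₃ (insert c₂ L')) := by rw [Set.insert_comm]; exact hv'
    exact hbH (mem_closure_of_two_sides hLE hL hc₃ hc₁ hc₂ hC₃ hbE hLH h3 hv₀ hv₁)
  -- three coloops in `H` would put the whole spanning set into a hyperplane
  have three : L' ⊆ N.closure (W \ {b}) → c₁ ∈ N.closure (W \ {b}) → c₂ ∈ N.closure (W \ {b}) →
      c₃ ∈ N.closure (W \ {b}) → False := by
    intro hLH h1 h2 h3
    have hsub : insert c₁ (insert c₂ (insert c₃ L')) ⊆ N.closure (W \ {b}) :=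
      Set.insert_subset h1 (Set.insert_subset h2 (Set.insert_subset h3 hLH))
    have hrk : N.eRk (insert c₁ (insert c₂ (insert c₃ L'))) ≤ N.eRk (N.closure (W \ {b})) := N.eRk_mono hsub
    rw [hC, N.eRk_closure_eq, hR4] at hrk
    have : (5 : ℕ) ≤ 4 := by exact_mod_cast hrk
    omega
  -- now make `H` opaque
  generalize hH : N.closure (W \ {b}) = H at hbH two₁ two₂ two₃ three ⊢
  by_cases hLH : L' ⊆ H
  · -- CASE II: `L' ⊆ H`; find a valid coloop off `H`
    have off : ∀ c ∈ ({c₁, c₂, c₃} : Set α), c ∉ H → b ∉ N.closure (L' ∪ ({c₁, c₂, c₃} \ {c})) →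
        ∃ c ∈ ({c₁, c₂, c₃} : Set α), b ∉ N.closure (L' ∪ ({c₁, c₂, c₃} \ {c})) ∧
          ∃ ℓ ∈ L', ¬ ({ℓ, c} ⊆ H) := by
      intro c hc hcH hval
      obtain ⟨ℓ, hℓ⟩ : L'.Nonempty := by rw [← Set.ncard_pos hfin]; omega
      exact ⟨c, hc, hval, ℓ, hℓ, fun hsub => hcH (hsub (Set.mem_insert_of_mem ℓ rfl))⟩
    -- two coloops in `H` make `H` their side, which misses `b`
    have side : ∀ c c' : α, c ∈ H → c' ∈ H → b ∉ N.closure (insert c (insert c' L')) := by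
      intro c c' hcH hc'H hbin
      rw [← hH] at hcH hc'H hLH hbH
      exact hbH (N.closure_subset_closure_of_subset_closure
        (Set.insert_subset hcH (Set.insert_subset hc'H hLH)) hbin)
    by_cases h1 : c₁ ∈ H
    · by_cases h2 : c₂ ∈ H
      · have h3 : c₃ ∉ H := fun h3 => three hLH h1 h2 h3
        exact off c₃ hm₃ h3 (v₃ (side c₁ c₂ h1 h2))
      · by_cases h3 : c₃ ∈ H
        · exact off c₂ hm₂ h2 (v₂ (side c₁ c₃ h1 h3))
        · by_cases hv₂ : b ∉ N.closure (insert c₁ (insert c₃ L'))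
          · exact off c₂ hm₂ h2 (v₂ hv₂)
          · by_cases hv₃ : b ∉ N.closure (insert c₁ (insert c₂ L'))
            · exact off c₃ hm₃ h3 (v₃ hv₃)
            · exact absurd (two₁ hLH h1 (not_not.mp hv₃) (not_not.mp hv₂)) id
    · by_cases h2 : c₂ ∈ H
      · by_cases h3 : c₃ ∈ H
        · exact off c₁ hm₁ h1 (v₁ (side c₂ c₃ h2 h3))
        · by_cases hv₁ : b ∉ N.closure (insert c₂ (insert c₃ L'))
          · exact off c₁ hm₁ h1 (v₁ hv₁)
          · by_cases hv₃ : b ∉ N.closure (insert c₁ (insert c₂ L'))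
            · exact off c₃ hm₃ h3 (v₃ hv₃)
            · exact absurd (two₂ hLH h2 (not_not.mp hv₃) (not_not.mp hv₁)) id
      · by_cases h3 : c₃ ∈ H
        · by_cases hv₁ : b ∉ N.closure (insert c₂ (insert c₃ L'))
          · exact off c₁ hm₁ h1 (v₁ hv₁)
          · by_cases hv₂ : b ∉ N.closure (insert c₁ (insert c₃ L'))
            · exact off c₂ hm₂ h2 (v₂ hv₂)
            · exact absurd (two₃ hLH h3 (not_not.mp hv₂) (not_not.mp hv₁)) id
        · rcases exists_notMem_closure_of_triangle hLE hL hc₁ hc₂ hc₃ hC hbE hbL with hv | hv | hv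
          · exact off c₁ hm₁ h1 (v₁ hv)
          · exact off c₂ hm₂ h2 (v₂ hv)
          · exact off c₃ hm₃ h3 (v₃ hv)
  · -- CASE I: `L' ⊄ H`; a valid coloop by the triangle lemma, a line point off `H` by the degree bound
    have hcnt : 0 < (L' \ H).ncard := by
      have h1 : (L' ∩ H).ncard ≤ 2 := by
        rw [← hH] at hLH ⊢
        exact ncard_inter_closure_le_two hLE hnl hnt hL.le hLH
      have h2 := Set.ncard_inter_add_ncard_sdiff_eq_ncard L' H hfin
      omega
    obtain ⟨ℓ, hℓ⟩ : (L' \ H).Nonempty := by rw [← Set.ncard_pos (hfin.subset Set.sdiff_subset)]; omega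
    have serve : ∀ c, ¬ ({ℓ, c} ⊆ H) := fun c hsub => hℓ.2 (hsub (Set.mem_insert ℓ {c}))
    rcases exists_notMem_closure_of_triangle hLE hL hc₁ hc₂ hc₃ hC hbE hbL with hv | hv | hv
    · exact ⟨c₁, hm₁, v₁ hv, ℓ, hℓ.1, serve c₁⟩
    · exact ⟨c₂, hm₂, v₂ hv, ℓ, hℓ.1, serve c₂⟩
    · exact ⟨c₃, hm₃, v₃ hv, ℓ, hℓ.1, serve c₃⟩

end PercRepro
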